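import Literature.MathematicalPhysics.QuantumFieldTheory.Balaban1983to89.B9Eq352GradLetters
import Literature.MathematicalPhysics.QuantumFieldTheory.Balaban1983to89.B9Eq371Composition

/-!
# `Balaban1983to89.B9Eq371GradLetters` — B9 pp. 404–405 (3.71)/(3.73) with p. 407 «The operator V₃(A) is a local differential
# operator of the first order satisfying the bound (3.73)»: THE FIRST-ORDER PART `Σ_ν[seven-term bracket]_ν` OF THE VECTOR
# OPERATOR `V₁(A)` OF (3.71) IN GRADIENT FORM `V⁰ + Σ_k V¹_k∇_k` ON THE BOND CARRIER, letter by letter, with the (3.73) letter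
# sizes `|V⁰| ≦ O(1)α₁(Lʲη)⁻²`, `|V¹_k| ≦ O(1)α₁(Lʲη)⁻¹` as block majorants after real coordinates — the G-side twin of
# `B9Eq352GradLetters` (the scalar `V′₁` of (3.52)), first file

statement-level skeleton of published theorems with citation tags; proofs where landed; nothing here is a claim about the Yang–Mills mass gap

CITATION HEADER (lean-in-tree rule).  T. Bałaban, *Propagators for lattice gauge theories in a background field*, Commun.
Math. Phys. **99** (1985) 389–434 [Balaban1985BackgroundPropagators] (cell paper B9; held `paper:balaban1985-cmp99-background-
propagators`, journal page = PDF page + 388).  PDF held: pp. 404–405 [PDF 16–17] (3.71)–(3.73) and p. 407 [PDF 19] (3.82)–(3.85),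
read by this seat on the renders `b2b-balaban-ref1/pages/…-p016-x2.png`, `…-p017-x2.png`, `…-p019-x2.png` (2026-08-21); the
seven-term bracket is transcribed verbatim in `B9Eq371Composition` (pv27, the docstring of `sBracket`), which this file
imports BY NAME.  THE PRINT (verbatim, p. 405 and p. 407): «= (D\*DA′)_μ(x) − Σ_{ν=1}^d [R(U(x, x − ηe_ν))iad_{A_ν(x−ηe_ν)}
(DA′)_{νμ}(x − ηe_ν) − iad_{(D\*_νA_ν)(x)}A′_μ(x) + R(U(x, x − ηe_ν))iad_{A_μ(x−ηe_ν)}(D_μA′_ν)(x − ηe_ν) + iad_{A_ν(x)}(D_νA′_μ)(x)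
− iad_{A_μ(x)}(D_μA′_ν)(x) + iad_{(D\*_νA_μ)(x)}R(U(x, x − ηe_ν))A′_ν(x − ηe_ν) + iad_{A_μ(x)}(D\*_νA′_ν)(x)] − (F_{1,k}(A)A′)_μ(x)
= (D\*DA′)_μ(x) − (V₁(A)A′)_μ(x). (3.71)»; «The operator V₁ satisfies |(V₁(A)A′)(b)| ≦ O(1)(|A||∇A′| + |∇A||A′| + |A|²|A′|) ≦
O(1)α₁((Lʲη)⁻¹|∇A′| + (Lʲη)⁻²|A′|), b ∈ Ω_j, (3.73)»; p. 407: «The operator V₃(A) is a local differential operator of the first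
order satisfying the bound (3.73).»; (3.37) p. 396: «|A′| < α₁(Lʲη)⁻¹, |∇^η_UA′| < α₁(Lʲη)⁻² on Ω_j».  [4] = T. Bałaban,
*Propagators and renormalization transformations for lattice gauge theories. II*, Commun. Math. Phys. **96** (1984) 223–250
[Balaban1984PropagatorsII], (2.51)–(2.52) p. 232.  Cell `lit-balaban`, seat r06 (B9 fold owner) gen 10; SKELETON rows
**B9.Eq3.71** × **B9.Eq3.85** × B9.Thm3.4 (the `hV0`/`hV1` letter hypotheses of this seat's G-side devices
`B9Ineq385VG.ineq385_op`, `B9Ineq386CommSum.ineq385_op_sum` / `thm34_G_entries13_opForm_of_comm_sum`, for the `V₁`-part of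
`V₃ = V₁ − (Δ′(U′U) − Δ′(U)) + V₂`).

WHY THIS FILE, AND WHY «GRADIENT FORM» IS A READING.  The G-side devices of gens 7–8 take `V₃ = V⁰ + Σ_{k} V¹_k·∇_k` with block
majorants `V⁰ ≺ c_Vα₁(Lʲη)⁻²e^{−δd}`, `V¹_k ≺ c_{1,k}α₁(Lʲη)⁻¹e^{−δd}` as HYPOTHESES (`hV0`, `hV1`) — this seat's operator READING
of the print's sentence «local differential operator of the first order satisfying (3.73)»; the print displays no such
decomposition.  Gens 8–9 discharged those hypotheses for the scalar `V′(A)` of (3.52)/(3.60) (`B9Eq352GradLetters`,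
`B9Eq360VprimeLetters`).  THIS FILE starts the same for the vector side: the seven-term bracket of (3.71), as pv27 typed it
(`B9Eq371Composition.sBracket`, ×η²), is rewritten EXACTLY as `V⁰ + Σ_{k∈κ⊕κ} V¹_k∇_k` on the BOND CARRIER `κ × S` (a bond
function `A′ : κ → S → 𝔸` read as a function on `κ × S`; the componentwise covariant differences are gen 8's letters on that
carrier for the shifts `bT` and the background `bU`), with EXPLICIT local letters, and each letter gets its (3.73)-size block
majorant from (3.37) read blockwise, by gen 8's seam lemma `B9Eq352DivFormLetters.hasMajorant_conj_of_local`.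

WHAT THIS FILE PROVES (0 sorry; defs with bodies + theorems; no `def … : Prop`).
* §1 `bT`, `bU`, `Ab` — the bond carrier: shifts `(μ, x) ↦ (μ, x + e_k)`, background `U_k(x)`, exponent field read on bonds;
  `covD_bond`/`covDstar_bond`/`tauB_bond`: gen 8's covariant differences/transports on `κ × S` ARE the componentwise ones.
* §2 the letters (all `Module.End ℝ (κ × S → 𝔸)`): `zeroLetter c A` (terms 2 and 6 of the bracket: `−iad_{c·D¹*_νA_ν(x)}` on the
  component μ and `iad_{c·D¹*_νA_μ(x)}∘τ*_ν` from the component ν), `mixLetterF A k₀` (terms 1b, 3, 5: the coefficients of the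
  forward difference `∇_{k₀}` that MIX components — output component `k₀`, input components ν, with the transports `τ*_ν`),
  `mixLetterB A k₀` (term 7: `−iad_{A_μ(x)}` reading the component `k₀`), and `V1Letter A k` = gen 8's `coefLetter` on the bond
  carrier (terms 4 and 1a, DIAGONAL in the component) `+` the mixing letter; `V₁brkOp c A := zeroLetter + Σ_k V1Letter k ∘ diffLetter
  c k` — the first-order part of `V₁(A)` DEFINED in gradient form.
* §3 `brk` (the bracket in true units, ordered as the letters read it), `sBracket_eq_brk` (pv27's `sBracket_ν = η²·brk_ν`, term
  by term: 1 = 1a + 1b via `R(V)[b,Z] = [R(V)b, R(V)Z]` and `τ*_ν(D¹_νf) = −D¹*_νf` (`tauB_covD`), the rest scalar bookkeeping),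
  `V₁brkOp_apply` (the letters read the bracket: 2 and 6 ↦ `V⁰`, 3/5/1b ↦ `mixLetterF` after the indicator sum, 4/1a ↦
  `coefLetter`, 7 ↦ `mixLetterB`), and **`sum_sBracket_eq`** — THE IDENTITY: for `η ≠ 0`, `Σ_ν sBracket T U η A A′ ν μ x =
  η²·(V₁brkOp η⁻¹ A)(A′)(μ, x)`; with pv27's `lapDD_prodCfg_eq_sBracket`: `D¹*D¹_{U′U}A′ = D¹*D¹_UA′ − η²·V₁brkOp(A′) − F₁op`
  (`lapDD_prodCfg_eq_gradForm`).
* §4 THE (3.73) LETTER SIZES as block majorants after real coordinates (`conj b`, carrier `(κ × S) × ι`, block map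
  `((μ,x),i) ↦ y(x)`), every O(1) explicit (private elementary tools `norm_I_ad_le`, `norm_Rinv_le_sq`, `R_real_smul`):
  `hasMajorant_coefLetter_bond` (gen 8's `hasMajorant_coefLetter` on the bond carrier, `≺ 2M₂(Σ‖b_i‖)e^{δd₀}·α₁(Lʲη)⁻¹e^{−δd}`),
  `hasMajorant_mixLetterF` (`≺ 2(1+2ρ²)d·M₂(Σ‖b_i‖)e^{δd₀}·α₁(Lʲη)⁻¹e^{−δd}`), `hasMajorant_mixLetterB` (`≺ 2M₂(Σ‖b_i‖)e^{δd₀}·α₁(Lʲη)⁻¹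
  e^{−δd}`), **`hasMajorant_V1Letter`** (the `hV1` shape for every `k ∈ κ ⊕ κ`, one constant `2(2+2ρ²)(d+1)M₂(Σ‖b_i‖)e^{δd₀}`),
  **`hasMajorant_zeroLetter`** (the `hV0` shape for the bracket part, `≺ 2(1+ρ²)d·M₂(Σ‖b_i‖)e^{δd₀}·α₁(Lʲη)⁻²e^{−δd}`), and the
  conjugated gradient form `conj_V₁brkOp_eq_gradForm` (the `hV₃`-shape identity for this part).

HONEST SCOPE / NOT CLAIMED.  (i) ONLY the first-order bracket of `V₁(A)`; the higher-order part `F_{1,k}(A)` ((3.72), pv27's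
`F₁op`), the curvature difference `Δ′(U′U) − Δ′(U)` and `V₂(A)` of (3.75) — the other summands of `V₃` — are NOT treated here
(successor files), so no hypothesis of the G-side devices is discharged for the full `V₃` yet.  (ii) No commutator letters
`[V¹_k, ∇_k]` (the divergence form needed for the RIGHT entry (3.42)₃ of `G(U′U)`): for the mixing letters these involve
transports across directions, hence the plaquette curvature of `U` ((3.35)), and are deferred.  (iii) (3.37) enters BLOCKWISE for
the letters as they occur: `‖A_k(x)‖`, `‖τ*_νA_k(x)‖ ≦ α₁(Lʲη)⁻¹` and `‖η⁻¹D¹*_νA_k(x)‖ ≦ α₁(Lʲη)⁻²` for ALL pairs (ν, k), `x ∈ Δ(y)`,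
`y ∈ Λ_j` (the print's `|A|`, `|∇A|` on `st(b)`); transports `‖U‖, ‖U⁻¹‖ ≦ ρ`; stencil geometry `d(y(x), y(x ± e_ν)) ≦ d₀`,
`d(y,y) ≦ d₀`; `𝔸` finite-dimensional over ℝ with basis `b`, `|b.repr v i| ≦ M₂‖v‖`.  (iv) «Gradient form» is this seat's
reading (see WHY).  (v) Abstract carrier: arbitrary sites `S`, directions `κ`, shifts `T`, units `U` (no commutation of
shifts, no unitarity needed here).  Value = the `V₁`-bracket third of the `hV0`/`hV1` inputs of the G-side Theorem-3.4 devices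
made theorems about concrete lattice operators; NOT summit progress.

RELATED IN THE TREE, NOT DUPLICATED (searched 2026-08-21: `lean search --decl 'mixLetter|V₁brkOp|covD_bond'` = ∅; the string
`zeroLetter` occurs only inside theorem names of `Summits/QuantumFields/BalabanUV/Beta/WilsonLetterSocketFit` (an unrelated
object in another namespace);
`B9Eq371Composition`/`B9Eq372Locality`/`B9Eq372Operator` (pv27) give `V₁(A)A′` pointwise, its locality and its operator norm
— USED (the bracket) / complementary (norms); `B9Eq352GradLetters` is the scalar twin whose letters `coefLetter`,
`diffLetter`, `mulLetter` are RE-USED on the bond carrier, not re-declared).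
-/

noncomputable section

namespace Literature.MathematicalPhysics.QuantumFieldTheory.Balaban1983to89.B9Eq371GradLetters

open NormedSpace Complex
open Literature.MathematicalPhysics.QuantumFieldTheory.Balaban1983to89
open Literature.MathematicalPhysics.QuantumFieldTheory.Balaban1983to89.B6RandomWalk (HasMajorant hasMajorant_mono
  hasMajorant_add)
open Literature.MathematicalPhysics.QuantumFieldTheory.Balaban1983to89.B9Thm34Ext (toB6)
open Literature.MathematicalPhysics.QuantumFieldTheory.Balaban1983to89.Beta.BackgroundVertices (ad norm_ad_le ad_smul_right
  ad_smul_left ad_add_right ad_sub_right ad_add_left ad_sub_left ad_apply)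
open Literature.MathematicalPhysics.QuantumFieldTheory.Balaban1983to89.B9Eq39Adjoint
open Literature.MathematicalPhysics.QuantumFieldTheory.Balaban1983to89.B9Eq370Expansion (norm_R_le)
open Literature.MathematicalPhysics.QuantumFieldTheory.Balaban1983to89.B9Eq371Composition (sBracket R_ad norm_R_le_sq
  lapDD F₁op lapDD_prodCfg_eq_sBracket)
open Literature.MathematicalPhysics.QuantumFieldTheory.Balaban1983to89.B9Eq352DivForm (tauB tauB_apply)
open Literature.MathematicalPhysics.QuantumFieldTheory.Balaban1983to89.B9Eq352DivFormLetters
open Literature.MathematicalPhysics.QuantumFieldTheory.Balaban1983to89.B9Eq352GradLetters (coefLetter diffLetter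
  coefLetter_inl coefLetter_inr diffLetter_inl diffLetter_inr conj_add conj_finset_sum hasMajorant_coefLetter)

/-! ## §1  The bond carrier `κ × S`: componentwise covariant differences are gen 8's letters for the shifts `bT`, background `bU` -/

section Carrier

variable {𝔸 : Type*} [Ring 𝔸] {S : Type} {κ : Type}
variable (T : κ → Equiv.Perm S) (U : κ → S → 𝔸ˣ)

/-- The shift `x ↦ x + e_k` acting on bonds `(μ, x)` componentwise: `(μ, x) ↦ (μ, x + e_k)` (the bond function
`A′_μ(x) = A′(x, x + ηe_μ)` of p. 391 read as a function on `κ × S`). [cite: Balaban1985BackgroundPropagators, (3.3)–(3.4) p.390–391] -/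
def bT (k : κ) : Equiv.Perm (κ × S) := (Equiv.refl κ).prodCongr (T k)

/-- The background on the bond carrier: `U_k` at the site of the bond. [cite: Balaban1985BackgroundPropagators, (3.3) p.391] -/
def bU (k : κ) : κ × S → 𝔸ˣ := fun p => U k p.2

/-- The exponent field `A` of `U′ = e^{iηA}` read on the bond carrier (constant in the component index).
[cite: Balaban1985BackgroundPropagators, (3.37) p.396 + (3.71) p.404] -/
def Ab {𝔹 : Type*} (A : κ → S → 𝔹) : κ → κ × S → 𝔹 := fun k p => A k p.2

omit U in
/-- `bT k (μ, x) = (μ, x + e_k)`. [cite: Balaban1985BackgroundPropagators, (3.3) p.391] -/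
@[simp] theorem bT_apply (k : κ) (p : κ × S) : bT T k p = (p.1, T k p.2) := rfl

omit U in
/-- `(bT k)⁻¹ (μ, x) = (μ, x − e_k)`. [cite: Balaban1985BackgroundPropagators, (3.5) p.391] -/
@[simp] theorem bT_symm_apply (k : κ) (p : κ × S) : (bT T k).symm p = (p.1, (T k).symm p.2) := rfl

omit T in
/-- `bU k (μ, x) = U_k(x)`. [cite: Balaban1985BackgroundPropagators, (3.3) p.391] -/
@[simp] theorem bU_apply (k : κ) (p : κ × S) : bU U k p = U k p.2 := rfl

omit [Ring 𝔸] T U in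
/-- `Ab A k (μ, x) = A_k(x)`. [cite: Balaban1985BackgroundPropagators, (3.37) p.396] -/
@[simp] theorem Ab_apply {𝔹 : Type*} (A : κ → S → 𝔹) (k : κ) (p : κ × S) : Ab A k p = A k p.2 := rfl

/-- **The componentwise covariant difference is gen 8's `covD` on the bond carrier**: `(D¹_kF)(μ, x) = R(U_k(x))F(μ, x+e_k) −
F(μ, x)` («The derivatives are, of course, the covariant derivatives defined by U», p. 405).
[cite: Balaban1985BackgroundPropagators, (3.3) p.391 + (3.73) p.405] -/
theorem covD_bond (k : κ) (F : κ × S → 𝔸) (p : κ × S) :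
    covD (bT T) (bU U) k F p = covD T U k (fun z => F (p.1, z)) p.2 := rfl

/-- The componentwise backward covariant difference (3.8) on the bond carrier. [cite: Balaban1985BackgroundPropagators, (3.8) p.392] -/
theorem covDstar_bond (k : κ) (F : κ × S → 𝔸) (p : κ × S) :
    covDstar (bT T) (bU U) k F p = covDstar T U k (fun z => F (p.1, z)) p.2 := rfl

/-- The componentwise backward transport `(τ*_kF)(μ, x) = R(U(x, x−e_k))F(μ, x−e_k)` on the bond carrier.
[cite: Balaban1985BackgroundPropagators, (3.5) p.391 + (3.71) p.404] -/
theorem tauB_bond (k : κ) (F : κ × S → 𝔸) (p : κ × S) :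
    tauB (bT T) (bU U) k F p = tauB T U k (fun z => F (p.1, z)) p.2 := rfl

/-- The transported coefficient on the bond carrier is the transported coefficient: `τ*_k(Ab A k)(μ, x) = (τ*_kA_k)(x)`.
[cite: Balaban1985BackgroundPropagators, (3.71) p.404] -/
theorem tauB_Ab (A : κ → S → 𝔸) (k : κ) (p : κ × S) :
    tauB (bT T) (bU U) k (Ab A k) p = tauB T U k (A k) p.2 := rfl

/-- `τ*_ν(D¹_νf)(x) = −(D¹*_νf)(x)` — transporting the forward difference at `x − e_ν` back to `x` gives minus the backward
difference (term 1 of the bracket: `R(U(x,x−e_ν))(D_νA′_μ)(x−e_ν) = −(D*_νA′_μ)(x)`). [cite: Balaban1985BackgroundPropagators, (3.3) p.391 + (3.8) p.392 + (3.5) p.391] -/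
theorem tauB_covD (ν : κ) (f : S → 𝔸) (x : S) :
    tauB T U ν (covD T U ν f) x = -covDstar T U ν f x := by
  simp only [tauB_apply, covD, covDstar, R_sub, R_inv_R, Equiv.apply_symm_apply]
  abel

/-- The transport bound `‖R(V)⁻¹Z‖ ≦ ρ²‖Z‖` for `‖V‖, ‖V⁻¹‖ ≦ ρ` (pv27's `norm_R_le_sq` at `V⁻¹`). [folklore] -/
private theorem norm_Rinv_le_sq {𝔹 : Type*} [NormedRing 𝔹] (V : 𝔹ˣ) {ρ : ℝ} (h1 : ‖(V : 𝔹)‖ ≤ ρ)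
    (h2 : ‖((V⁻¹ : 𝔹ˣ) : 𝔹)‖ ≤ ρ) (Z : 𝔹) : ‖R V⁻¹ Z‖ ≤ ρ ^ 2 * ‖Z‖ :=
  norm_R_le_sq V⁻¹ h2 (by simpa using h1) Z

end Carrier

/-! ## §2  The letters of the seven-term bracket on the bond carrier -/

section Letters0

variable {𝔸 : Type*} [NormedRing 𝔸] [NormedAlgebra ℂ 𝔸] {S : Type} {κ : Type}
variable (T : κ → Equiv.Perm S) (U : κ → S → 𝔸ˣ)

omit [NormedAlgebra ℂ 𝔸] in
/-- `R(V)(r·X) = r·R(V)X` for REAL scalars. [folklore] -/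
private theorem R_real_smul [NormedAlgebra ℂ 𝔸] (V : 𝔸ˣ) (r : ℝ) (X : 𝔸) : R V (r • X) = r • R V X := by
  rw [R_def, R_def, mul_smul_comm, smul_mul_assoc]

omit T U in
/-- **The mixing coefficient letter of the backward difference along `k₀` (term 7)**: `F ↦ ((μ,x) ↦ −i[A_μ(x), F_{k₀}(x)])` —
the coefficient of «iad_{A_μ(x)}(D*_νA′_ν)(x)» read against gen 8's backward letter `∇_{inr ν} = −η⁻¹D¹*_ν`.
[cite: Balaban1985BackgroundPropagators, (3.71) p.405 + (3.73) p.405] -/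
def mixLetterB (A : κ → S → 𝔸) (k₀ : κ) : Module.End ℝ (κ × S → 𝔸) where
  toFun F := fun p => -((I : ℂ) • ad (A p.1 p.2) (F (k₀, p.2)))
  map_add' F F' := by
    funext p
    simp only [Pi.add_apply, ad_add_right, smul_add, neg_add]
  map_smul' r F := by
    funext p
    simp only [Pi.smul_apply, RingHom.id_apply, ad_smul_right, smul_neg]
    rw [smul_comm r (I : ℂ)]

omit T U in
/-- Unfolding `mixLetterB`. [cite: Balaban1985BackgroundPropagators, (3.71) p.405] -/
theorem mixLetterB_apply (A : κ → S → 𝔸) (k₀ : κ) (F : κ × S → 𝔸) (p : κ × S) :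
    mixLetterB A k₀ F p = -((I : ℂ) • ad (A p.1 p.2) (F (k₀, p.2))) := rfl

variable [Fintype κ]

/-- **`V⁰` of the bracket (terms 2 and 6)**: `F ↦ ((μ,x) ↦ Σ_ν ( −i[c·(D¹*_νA_ν)(x), F(μ,x)] + i[c·(D¹*_νA_μ)(x), (τ*_νF_ν)(x)] ))`,
`c = η⁻¹` — the zeroth-order letters «− iad_{(D*_νA_ν)(x)}A′_μ(x)» and «iad_{(D*_νA_μ)(x)}R(U(x, x − ηe_ν))A′_ν(x − ηe_ν)».
[cite: Balaban1985BackgroundPropagators, (3.71) p.404–405 + (3.73) p.405] -/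
def zeroLetter (c : ℂ) (A : κ → S → 𝔸) : Module.End ℝ (κ × S → 𝔸) where
  toFun F := fun p => ∑ ν, (-((I : ℂ) • ad (c • covDstar T U ν (A ν) p.2) (F p))
    + (I : ℂ) • ad (c • covDstar T U ν (A p.1) p.2) (tauB T U ν (fun z => F (ν, z)) p.2))
  map_add' F F' := by
    funext p
    dsimp only [Pi.add_apply]
    rw [← Finset.sum_add_distrib]
    refine Finset.sum_congr rfl fun ν _ => ?_
    simp only [tauB_apply, R_add, ad_add_right, smul_add, neg_add]
    abel
  map_smul' r F := by
    funext p
    dsimp only [Pi.smul_apply, RingHom.id_apply]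
    rw [Finset.smul_sum]
    refine Finset.sum_congr rfl fun ν _ => ?_
    simp only [tauB_apply, R_real_smul, ad_smul_right, smul_add, smul_neg]
    rw [smul_comm r (I : ℂ), smul_comm r (I : ℂ)]

/-- Unfolding `zeroLetter`. [cite: Balaban1985BackgroundPropagators, (3.71) p.404–405] -/
theorem zeroLetter_apply (c : ℂ) (A : κ → S → 𝔸) (F : κ × S → 𝔸) (p : κ × S) :
    zeroLetter T U c A F p = ∑ ν, (-((I : ℂ) • ad (c • covDstar T U ν (A ν) p.2) (F p))
      + (I : ℂ) • ad (c • covDstar T U ν (A p.1) p.2) (tauB T U ν (fun z => F (ν, z)) p.2)) := rfl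

variable [DecidableEq κ]

/-- **The mixing coefficient letter of the forward difference `∇_{k₀}` (terms 1b, 3, 5)**: `F ↦ ((μ,x) ↦ 𝟙[μ = k₀]·Σ_ν
( −i[(τ*_νA_ν)(x), (τ*_νF_ν)(x)] + i[(τ*_νA_{k₀})(x), (τ*_νF_ν)(x)] − i[A_{k₀}(x), F_ν(x)] ))` — the coefficients of
`(D_μA′_ν)` in «R(U(x,x−e_ν))iad_{A_ν(x−e_ν)}(DA′)_{νμ}(x−e_ν)» (its `−D_μA′_ν` half), «R(U(x,x−e_ν))iad_{A_μ(x−e_ν)}(D_μA′_ν)(x−e_ν)»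
and «− iad_{A_μ(x)}(D_μA′_ν)(x)», the derivative direction being the OUTPUT component μ = k₀ and the input component ν.
[cite: Balaban1985BackgroundPropagators, (3.71) p.404–405 + (3.73) p.405] -/
def mixLetterF (A : κ → S → 𝔸) (k₀ : κ) : Module.End ℝ (κ × S → 𝔸) where
  toFun F := fun p => (if p.1 = k₀ then (1 : ℝ) else 0) • ∑ ν,
    (-((I : ℂ) • ad (tauB T U ν (A ν) p.2) (tauB T U ν (fun z => F (ν, z)) p.2))
      + (I : ℂ) • ad (tauB T U ν (A k₀) p.2) (tauB T U ν (fun z => F (ν, z)) p.2)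
      - (I : ℂ) • ad (A k₀ p.2) (F (ν, p.2)))
  map_add' F F' := by
    funext p
    dsimp only [Pi.add_apply]
    rw [← smul_add (if p.1 = k₀ then (1 : ℝ) else 0), ← Finset.sum_add_distrib]
    congr 1
    refine Finset.sum_congr rfl fun ν _ => ?_
    simp only [tauB_apply, R_add, ad_add_right, smul_add]
    abel
  map_smul' r F := by
    funext p
    dsimp only [Pi.smul_apply, RingHom.id_apply]
    rw [smul_comm r (if p.1 = k₀ then (1 : ℝ) else 0)]
    congr 1
    rw [Finset.smul_sum]
    refine Finset.sum_congr rfl fun ν _ => ?_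
    simp only [tauB_apply, R_real_smul, ad_smul_right, smul_add, smul_sub, smul_neg]
    rw [smul_comm r (I : ℂ), smul_comm r (I : ℂ), smul_comm r (I : ℂ)]

/-- Unfolding `mixLetterF`. [cite: Balaban1985BackgroundPropagators, (3.71) p.404–405] -/
theorem mixLetterF_apply (A : κ → S → 𝔸) (k₀ : κ) (F : κ × S → 𝔸) (p : κ × S) :
    mixLetterF T U A k₀ F p = (if p.1 = k₀ then (1 : ℝ) else 0) • ∑ ν,
      (-((I : ℂ) • ad (tauB T U ν (A ν) p.2) (tauB T U ν (fun z => F (ν, z)) p.2))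
        + (I : ℂ) • ad (tauB T U ν (A k₀) p.2) (tauB T U ν (fun z => F (ν, z)) p.2)
        - (I : ℂ) • ad (A k₀ p.2) (F (ν, p.2))) := rfl

/-- **The coefficient letters `V¹_k` of the bracket**, `k ∈ κ ⊕ κ`: gen 8's DIAGONAL coefficient letter on the bond carrier
(`inl k₀`: `iad_{A_{k₀}(x)}`, term 4; `inr k₀`: `iad_{(τ*_{k₀}A_{k₀})(x)}`, term 1a) PLUS the component-mixing letter.
[cite: Balaban1985BackgroundPropagators, (3.71) p.404–405 + (3.73) p.405] -/
def V1Letter (A : κ → S → 𝔸) : κ ⊕ κ → Module.End ℝ (κ × S → 𝔸)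
  | Sum.inl k₀ => coefLetter (bT T) (bU U) (Ab A) (Sum.inl k₀) + mixLetterF T U A k₀
  | Sum.inr k₀ => coefLetter (bT T) (bU U) (Ab A) (Sum.inr k₀) + mixLetterB A k₀

/-- **THE FIRST-ORDER PART OF `V₁(A)` DEFINED IN GRADIENT FORM**: `V₁brkOp c A := V⁰ + Σ_{k∈κ⊕κ} V¹_k ∘ ∇_k` with gen 8's
difference letters `∇_{inl k₀} = c·D¹_{k₀}`, `∇_{inr k₀} = −c·D¹*_{k₀}` on the bond carrier (`c = η⁻¹`); §3 proves that `η²·V₁brkOp η⁻¹ A`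
IS pv27's `Σ_ν sBracket_ν`. [cite: Balaban1985BackgroundPropagators, (3.71) p.404–405 + (3.73) p.405] -/
def V₁brkOp (c : ℂ) (A : κ → S → 𝔸) : Module.End ℝ (κ × S → 𝔸) :=
  zeroLetter T U c A + ∑ k, V1Letter T U A k * diffLetter (bT T) (bU U) c k

/-- `V1Letter` on a forward index. [cite: Balaban1985BackgroundPropagators, (3.71) p.404–405] -/
theorem V1Letter_inl (A : κ → S → 𝔸) (k₀ : κ) :
    V1Letter T U A (Sum.inl k₀) = coefLetter (bT T) (bU U) (Ab A) (Sum.inl k₀) + mixLetterF T U A k₀ := rfl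

/-- `V1Letter` on a backward index. [cite: Balaban1985BackgroundPropagators, (3.71) p.404–405] -/
theorem V1Letter_inr (A : κ → S → 𝔸) (k₀ : κ) :
    V1Letter T U A (Sum.inr k₀) = coefLetter (bT T) (bU U) (Ab A) (Sum.inr k₀) + mixLetterB A k₀ := rfl

/-- `V₁brkOp` unfolds to the gradient form over `univ` (the `hV₃`-shape of the finite-sum device for this part, before
coordinates). [cite: Balaban1985BackgroundPropagators, (3.71) p.404–405 + (3.73) p.405] -/
theorem V₁brkOp_eq_gradForm (c : ℂ) (A : κ → S → 𝔸) :
    V₁brkOp T U c A = zeroLetter T U c A + ∑ k ∈ Finset.univ, V1Letter T U A k * diffLetter (bT T) (bU U) c k := rfl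

end Letters0

/-! ## §3  The identity: pv27's seven-term bracket, summed over ν, IS `η²·(V⁰ + Σ_k V¹_k∇_k)` -/

section Bracket

variable {𝔸 : Type*} [NormedRing 𝔸] [NormedAlgebra ℂ 𝔸] {S : Type} {κ : Type}
variable (T : κ → Equiv.Perm S) (U : κ → S → 𝔸ˣ)

/-- The seven-term bracket in TRUE UNITS, organised as the letters read it (`c = η⁻¹`; order: 1a, 1b, 2, 3, 4, 5, 6, 7).
[cite: Balaban1985BackgroundPropagators, (3.71) p.404–405] -/
def brk (c : ℂ) (A : κ → S → 𝔸) (F : κ × S → 𝔸) (ν μ : κ) (x : S) : 𝔸 :=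
  (I : ℂ) • ad (tauB T U ν (A ν) x) (-(c • covDstar T U ν (fun z => F (μ, z)) x))
  + -((I : ℂ) • ad (tauB T U ν (A ν) x) (tauB T U ν (fun z => c • covD T U μ (fun w => F (ν, w)) z) x))
  + -((I : ℂ) • ad (c • covDstar T U ν (A ν) x) (F (μ, x)))
  + (I : ℂ) • ad (tauB T U ν (A μ) x) (tauB T U ν (fun z => c • covD T U μ (fun w => F (ν, w)) z) x)
  + (I : ℂ) • ad (A ν x) (c • covD T U ν (fun z => F (μ, z)) x)
  + -((I : ℂ) • ad (A μ x) (c • covD T U μ (fun w => F (ν, w)) x))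
  + (I : ℂ) • ad (c • covDstar T U ν (A μ) x) (tauB T U ν (fun z => F (ν, z)) x)
  + (I : ℂ) • ad (A μ x) (c • covDstar T U ν (fun z => F (ν, z)) x)

omit [NormedAlgebra ℂ 𝔸] in
/-- `[a, −m] = −[a, m]`. [folklore] -/
private theorem ad_neg_right' (a m : 𝔸) : ad a (-m) = -ad a m := by
  simp only [ad_apply, mul_neg, neg_mul, neg_sub]
  abel

/-- **pv27's seven-term bracket IS `η²·brk`** (per direction ν; `η ≠ 0`), with `A′_ν(z) = F(ν, z)` — term 1 splits by
`R(V)[b, Z] = [R(V)b, R(V)Z]` and `τ*_ν(D¹_νf) = −D¹*_νf` into the diagonal term 1a and the mixing term 1b, term 3 is transported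
the same way; the rest is the scalar bookkeeping `iη·[a, Z] = η²·i·[a, η⁻¹Z]`.
[cite: Balaban1985BackgroundPropagators, (3.71) p.404–405] -/
theorem sBracket_eq_brk {η : ℝ} (hη : η ≠ 0) (A : κ → S → 𝔸) (F : κ × S → 𝔸) (ν μ : κ) (x : S) :
    sBracket T U η A (fun k z => F (k, z)) ν μ x = ((η : ℂ) ^ 2) • brk T U ((η : ℂ)⁻¹) A F ν μ x := by
  have hη' : (η : ℂ) ≠ 0 := Complex.ofReal_ne_zero.mpr hη
  have hs : (η : ℂ) ^ 2 * I * (η : ℂ)⁻¹ = I * η := by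
    field_simp
  simp only [sBracket, brk, curl, covD, covDstar, tauB_apply, R_ad, R_sub, R_smul, R_inv_R,
    Equiv.apply_symm_apply, ad_smul_left, ad_smul_right, ad_sub_left, ad_sub_right, ad_neg_right', smul_add, smul_sub,
    smul_neg, smul_smul, ← mul_assoc, hs]
  abel

end Bracket

section Identity

variable {𝔸 : Type*} [NormedRing 𝔸] [NormedAlgebra ℂ 𝔸] {S : Type} {κ : Type} [Fintype κ] [DecidableEq κ]
variable (T : κ → Equiv.Perm S) (U : κ → S → 𝔸ˣ)

/-- **The letters read the bracket**: `(V₁brkOp c A)(F)(μ, x) = Σ_ν brk_ν` (unfolding the gradient form: the diagonal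
coefficient letters give terms 4 and 1a, `mixLetterF` terms 1b/3/5 after `Σ_{k₀} 𝟙[μ = k₀]`, `mixLetterB` term 7, `zeroLetter`
terms 2 and 6). [cite: Balaban1985BackgroundPropagators, (3.71) p.404–405 + (3.73) p.405] -/
theorem V₁brkOp_apply (c : ℂ) (A : κ → S → 𝔸) (F : κ × S → 𝔸) (p : κ × S) :
    V₁brkOp T U c A F p = ∑ ν, brk T U c A F ν p.1 p.2 := by
  obtain ⟨μ, x⟩ := p
  simp only [V₁brkOp, V1Letter_inl, V1Letter_inr, coefLetter_inl, coefLetter_inr, diffLetter_inl, diffLetter_inr,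
    LinearMap.add_apply, LinearMap.sum_apply, Module.End.mul_apply, LinearMap.neg_apply, Fintype.sum_sum_type,
    Pi.add_apply, Finset.sum_apply, Pi.neg_apply, mulLetter_apply, gradLetterF_apply, gradLetterB_apply,
    zeroLetter_apply, mixLetterF_apply, mixLetterB_apply, covD_bond, covDstar_bond, tauB_Ab, Ab_apply]
  -- the indicator sum `Σ_{k₀} 𝟙[μ = k₀]·X k₀ = X μ`
  simp only [Finset.sum_add_distrib, ite_smul, one_smul, zero_smul, Finset.sum_ite_eq, Finset.mem_univ, if_true]
  simp only [brk, Finset.sum_add_distrib, Finset.sum_neg_distrib, Finset.sum_sub_distrib, tauB_apply, R_smul,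
    ad_smul_right, ad_neg_right', smul_neg]
  abel

/-- **THE IDENTITY (3.71) ⇆ gradient form**: for `η ≠ 0`, pv27's seven-term bracket summed over ν equals `η²` times the
gradient-form operator applied to `A′` read on the bond carrier: `Σ_ν sBracket T U η A A′ ν μ x = η²·(V₁brkOp η⁻¹ A)(A′)(μ, x)`.
[cite: Balaban1985BackgroundPropagators, (3.71) p.404–405 + (3.73) p.405] -/
theorem sum_sBracket_eq {η : ℝ} (hη : η ≠ 0) (A : κ → S → 𝔸) (F : κ × S → 𝔸) (μ : κ) (x : S) :
    ∑ ν, sBracket T U η A (fun k z => F (k, z)) ν μ x = ((η : ℂ) ^ 2) • V₁brkOp T U ((η : ℂ)⁻¹) A F (μ, x) := by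
  rw [V₁brkOp_apply, Finset.smul_sum]
  exact Finset.sum_congr rfl fun ν _ => sBracket_eq_brk T U hη A F ν μ x

/-- **(3.71) with the gradient form in place**: `(D¹*_{U′U}D¹_{U′U}A′)_μ(x) = (D¹*_UD¹_UA′)_μ(x) − η²·(V₁brkOp η⁻¹ A)(A′)(μ,x) −
(F_{1,k}(A)A′)_μ(x)` (pv27's `lapDD_prodCfg_eq_sBracket` — the penultimate expression of (3.71) — rewritten).
[cite: Balaban1985BackgroundPropagators, (3.71) p.404–405] -/
theorem lapDD_prodCfg_eq_gradForm [CompleteSpace 𝔸] {η : ℝ} (hη : η ≠ 0) (A : κ → S → 𝔸) (F : κ × S → 𝔸) (μ : κ)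
    (x : S) :
    lapDD T (prodCfg U η A) (fun k z => F (k, z)) μ x
      = lapDD T U (fun k z => F (k, z)) μ x - ((η : ℂ) ^ 2) • V₁brkOp T U ((η : ℂ)⁻¹) A F (μ, x)
        - F₁op T U η A (fun k z => F (k, z)) μ x := by
  rw [lapDD_prodCfg_eq_sBracket, sum_sBracket_eq T U hη]

end Identity

/-! ## §4  The (3.73) letter sizes as block majorants after real coordinates -/

section Majorants0

variable {𝔸 : Type*} [NormedRing 𝔸] [NormedAlgebra ℂ 𝔸] {ι : Type} [Fintype ι]
variable (b : Module.Basis ι ℝ 𝔸) {S : Type} {κ : Type}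
variable (T : κ → Equiv.Perm S) (U : κ → S → 𝔸ˣ)
variable {g : B9.Geometry} [Fintype g.Site] {Rr : ℝ} {H : Prop}

omit [Fintype ι] b T U [Fintype g.Site] in
/-- `‖i·[a, Z]‖ ≦ 2st` when `‖a‖ ≦ s`, `‖Z‖ ≦ t` (`‖i·X‖ = ‖X‖`, `‖[a,Z]‖ ≦ 2‖a‖‖Z‖`). [folklore] -/
private theorem norm_I_ad_le {a Z : 𝔸} {s t : ℝ} (ha : ‖a‖ ≤ s) (hZ : ‖Z‖ ≤ t) : ‖(I : ℂ) • ad a Z‖ ≤ 2 * s * t := by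
  rw [norm_smul, Complex.norm_I, one_mul]
  have hs : 0 ≤ s := (norm_nonneg _).trans ha
  exact (norm_ad_le _ _).trans (mul_le_mul (mul_le_mul_of_nonneg_left ha zero_le_two) hZ (norm_nonneg _) (by positivity))

/-- **`hV1` FOR THE DIAGONAL COEFFICIENT LETTERS ON THE BOND CARRIER** — gen 8's `hasMajorant_coefLetter` instantiated: under
(3.37) read blockwise (`‖A_k(x)‖`, `‖(τ*_kA_k)(x)‖ ≦ α₁(Lʲη)⁻¹` for `x ∈ Δ(y)`), `conj b (coefLetter (inl/inr k)) ≺ 2M₂(Σ‖b_i‖)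
e^{δd₀}·α₁(Lʲη)⁻¹·e^{−δd}` with respect to the block map `((μ,x),i) ↦ y(x)`.
[cite: Balaban1985BackgroundPropagators, (3.37) p.396 + (3.71) p.404 + (3.73) p.405; Balaban1984PropagatorsII, (2.51) p.232] -/
theorem hasMajorant_coefLetter_bond (blk : S → g.Site) (A : κ → S → 𝔸) (d₀ δ M₂ α₁ : ℝ)
    (hα₁ : 0 ≤ α₁) (hδ : 0 ≤ δ) (hM₂ : 0 ≤ M₂) (hrepr : ∀ (v : 𝔸) (i : ι), |b.repr v i| ≤ M₂ * ‖v‖)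
    (hlen : ∀ y : g.Site, 0 < g.len y)
    (hA : ∀ μ x, ‖A μ x‖ ≤ α₁ * (g.len (blk x))⁻¹ ∧ ‖tauB T U μ (A μ) x‖ ≤ α₁ * (g.len (blk x))⁻¹)
    (hd₀0 : ∀ y : g.Site, g.dist y y ≤ d₀) (k : κ ⊕ κ) :
    HasMajorant (g := toB6 g Rr H) (fun q : (κ × S) × ι => blk q.1.2) (conj b (coefLetter (bT T) (bU U) (Ab A) k))
      (fun y y' => (2 * M₂ * (∑ i, ‖b i‖) * Real.exp (δ * d₀)) * α₁ * (g.len y)⁻¹ * Real.exp (-(δ * g.dist y y'))) :=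
  hasMajorant_coefLetter (Rr := Rr) (H := H) b (bT T) (bU U) (fun p : κ × S => blk p.2) (Ab A) d₀ δ M₂ α₁ hα₁ hδ hM₂ hrepr
    hlen (fun μ p => hA μ p.2) hd₀0 k

omit T U in
/-- **`hV1` FOR THE BACKWARD MIXING LETTER** (term 7; block-diagonal stencil `{x}`): under `‖A_μ(x)‖ ≦ α₁(Lʲη)⁻¹` for `x ∈ Δ(y)`,
`conj b (mixLetterB A k₀) ≺ 2M₂(Σ‖b_i‖)e^{δd₀}·α₁(Lʲη)⁻¹·e^{−δd}`.
[cite: Balaban1985BackgroundPropagators, (3.37) p.396 + (3.71) p.405 + (3.73) p.405; Balaban1984PropagatorsII, (2.51) p.232] -/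
theorem hasMajorant_mixLetterB (blk : S → g.Site) (A : κ → S → 𝔸) (d₀ δ M₂ α₁ : ℝ)
    (hα₁ : 0 ≤ α₁) (hδ : 0 ≤ δ) (hM₂ : 0 ≤ M₂) (hrepr : ∀ (v : 𝔸) (i : ι), |b.repr v i| ≤ M₂ * ‖v‖)
    (hlen : ∀ y : g.Site, 0 < g.len y) (hA : ∀ k x, ‖A k x‖ ≤ α₁ * (g.len (blk x))⁻¹)
    (hd₀0 : ∀ y : g.Site, g.dist y y ≤ d₀) (k₀ : κ) :
    HasMajorant (g := toB6 g Rr H) (fun q : (κ × S) × ι => blk q.1.2) (conj b (mixLetterB A k₀))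
      (fun y y' => (2 * M₂ * (∑ i, ‖b i‖) * Real.exp (δ * d₀)) * α₁ * (g.len y)⁻¹ * Real.exp (-(δ * g.dist y y'))) := by
  have hc0 : ∀ y : g.Site, 0 ≤ 2 * α₁ * (g.len y)⁻¹ := fun y => by have := hlen y; positivity
  refine hasMajorant_mono (g := toB6 g Rr H) _
    (hasMajorant_conj_of_local (Rr := Rr) (H := H) b (fun p : κ × S => blk p.2) (fun p q => q.2 = p.2)
      (fun y => 2 * α₁ * (g.len y)⁻¹) d₀ δ M₂ hc0 hδ hM₂ hrepr (fun p q h => by rw [h]; exact hd₀0 _) (mixLetterB A k₀) ?_)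
    fun y y' => le_of_eq (by ring)
  intro F p B hB
  rw [mixLetterB_apply, norm_neg]
  calc ‖(I : ℂ) • ad (A p.1 p.2) (F (k₀, p.2))‖ ≤ 2 * (α₁ * (g.len (blk p.2))⁻¹) * B :=
        norm_I_ad_le (hA p.1 p.2) (hB (k₀, p.2) rfl)
    _ = 2 * α₁ * (g.len (blk p.2))⁻¹ * B := by ring

variable [Fintype κ]

/-- **`hV0` FOR THE ZEROTH-ORDER LETTER OF THE BRACKET** (terms 2 and 6): under (3.37) read blockwise for the DIFFERENCES of the
exponent field as they occur (`‖c·(D¹*_νA_k)(x)‖ ≦ α₁(Lʲη)⁻²` for all ν, k, `x ∈ Δ(y)`, `c = η⁻¹` — the print's `|∇A| < α₁(Lʲη)⁻²`),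
transports `≦ ρ` and the stencil geometry: `conj b (zeroLetter c A) ≺ 2(1+ρ²)d·M₂(Σ‖b_i‖)e^{δd₀}·α₁(Lʲη)⁻²·e^{−δd}` — the letter size
`|V⁰| ≦ O(1)α₁(Lʲη)⁻²` of the gradient-form reading of (3.73), bracket part (`d = card κ`).
[cite: Balaban1985BackgroundPropagators, (3.37) p.396 + (3.71) p.404–405 + (3.73) p.405; Balaban1984PropagatorsII, (2.51)–(2.52) p.232] -/
theorem hasMajorant_zeroLetter (blk : S → g.Site) (c : ℂ) (A : κ → S → 𝔸) (ρ d₀ δ M₂ α₁ : ℝ)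
    (hα₁ : 0 ≤ α₁) (hδ : 0 ≤ δ) (hM₂ : 0 ≤ M₂) (hrepr : ∀ (v : 𝔸) (i : ι), |b.repr v i| ≤ M₂ * ‖v‖)
    (h337 : ∀ ν k x, ‖c • covDstar T U ν (A k) x‖ ≤ α₁ * (g.len (blk x) ^ 2)⁻¹)
    (hρ : ∀ μ x, ‖((U μ x : 𝔸ˣ) : 𝔸)‖ ≤ ρ ∧ ‖(((U μ x)⁻¹ : 𝔸ˣ) : 𝔸)‖ ≤ ρ)
    (hd₀ : ∀ μ x, g.dist (blk x) (blk ((T μ).symm x)) ≤ d₀) (hd₀0 : ∀ y : g.Site, g.dist y y ≤ d₀) :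
    HasMajorant (g := toB6 g Rr H) (fun q : (κ × S) × ι => blk q.1.2) (conj b (zeroLetter T U c A))
      (fun y y' => (2 * (1 + ρ ^ 2) * Fintype.card κ * M₂ * (∑ i, ‖b i‖) * Real.exp (δ * d₀)) * α₁ *
        (g.len y ^ 2)⁻¹ * Real.exp (-(δ * g.dist y y'))) := by
  have hc0 : ∀ y : g.Site, 0 ≤ 2 * (1 + ρ ^ 2) * Fintype.card κ * α₁ * (g.len y ^ 2)⁻¹ := fun y => by positivity
  refine hasMajorant_mono (g := toB6 g Rr H) _
    (hasMajorant_conj_of_local (Rr := Rr) (H := H) b (fun p : κ × S => blk p.2)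
      (fun p q => q.2 = p.2 ∨ ∃ ν, q.2 = (T ν).symm p.2)
      (fun y => 2 * (1 + ρ ^ 2) * Fintype.card κ * α₁ * (g.len y ^ 2)⁻¹) d₀ δ M₂ hc0 hδ hM₂ hrepr ?_ (zeroLetter T U c A) ?_)
    fun y y' => le_of_eq (by ring)
  · rintro p q (h | ⟨ν, h⟩)
    · rw [h]; exact hd₀0 _
    · rw [h]; exact hd₀ ν p.2
  · intro F p B hB
    rw [zeroLetter_apply]
    have hterm : ∀ ν, ‖-((I : ℂ) • ad (c • covDstar T U ν (A ν) p.2) (F p))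
        + (I : ℂ) • ad (c • covDstar T U ν (A p.1) p.2) (tauB T U ν (fun z => F (ν, z)) p.2)‖
        ≤ 2 * (1 + ρ ^ 2) * (α₁ * (g.len (blk p.2) ^ 2)⁻¹) * B := by
      intro ν
      have hτF : ‖tauB T U ν (fun z => F (ν, z)) p.2‖ ≤ ρ ^ 2 * B := by
        rw [tauB_apply]
        refine (norm_Rinv_le_sq _ (hρ ν _).1 (hρ ν _).2 _).trans ?_
        exact mul_le_mul_of_nonneg_left (hB (ν, (T ν).symm p.2) (Or.inr ⟨ν, rfl⟩)) (sq_nonneg _)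
      have h1 : ‖(I : ℂ) • ad (c • covDstar T U ν (A ν) p.2) (F p)‖ ≤ 2 * (α₁ * (g.len (blk p.2) ^ 2)⁻¹) * B :=
        norm_I_ad_le (h337 ν ν p.2) (hB p (Or.inl rfl))
      have h2 : ‖(I : ℂ) • ad (c • covDstar T U ν (A p.1) p.2) (tauB T U ν (fun z => F (ν, z)) p.2)‖
          ≤ 2 * (α₁ * (g.len (blk p.2) ^ 2)⁻¹) * (ρ ^ 2 * B) :=
        norm_I_ad_le (h337 ν p.1 p.2) hτF
      calc _ ≤ ‖-((I : ℂ) • ad (c • covDstar T U ν (A ν) p.2) (F p))‖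
              + ‖(I : ℂ) • ad (c • covDstar T U ν (A p.1) p.2) (tauB T U ν (fun z => F (ν, z)) p.2)‖ :=
            norm_add_le _ _
        _ ≤ 2 * (α₁ * (g.len (blk p.2) ^ 2)⁻¹) * B + 2 * (α₁ * (g.len (blk p.2) ^ 2)⁻¹) * (ρ ^ 2 * B) := by
            rw [norm_neg]; exact add_le_add h1 h2
        _ = 2 * (1 + ρ ^ 2) * (α₁ * (g.len (blk p.2) ^ 2)⁻¹) * B := by ring
    refine (norm_sum_le _ _).trans ?_
    calc ∑ ν, ‖-((I : ℂ) • ad (c • covDstar T U ν (A ν) p.2) (F p))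
            + (I : ℂ) • ad (c • covDstar T U ν (A p.1) p.2) (tauB T U ν (fun z => F (ν, z)) p.2)‖
          ≤ ∑ _ν : κ, 2 * (1 + ρ ^ 2) * (α₁ * (g.len (blk p.2) ^ 2)⁻¹) * B := Finset.sum_le_sum fun ν _ => hterm ν
      _ = 2 * (1 + ρ ^ 2) * Fintype.card κ * α₁ * (g.len (blk p.2) ^ 2)⁻¹ * B := by
          rw [Finset.sum_const, Finset.card_univ, nsmul_eq_mul]; ring

variable [DecidableEq κ]

/-- **`hV1` FOR THE FORWARD MIXING LETTER** (terms 1b, 3, 5): under (3.37) read blockwise for the coefficients as they occur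
(`‖A_k(x)‖ ≦ α₁(Lʲη)⁻¹` and `‖(τ*_νA_k)(x)‖ ≦ α₁(Lʲη)⁻¹` for ALL ν, k, `x ∈ Δ(y)`), transports `‖U‖, ‖U⁻¹‖ ≦ ρ`, stencil geometry
`d(y(x), y(x−e_ν)) ≦ d₀`, `d(y,y) ≦ d₀`: `conj b (mixLetterF A k₀) ≺ 2(1+2ρ²)d·M₂(Σ‖b_i‖)e^{δd₀}·α₁(Lʲη)⁻¹·e^{−δd}` (`d = card κ`).
[cite: Balaban1985BackgroundPropagators, (3.37) p.396 + (3.71) p.404–405 + (3.73) p.405; Balaban1984PropagatorsII, (2.51) p.232] -/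
theorem hasMajorant_mixLetterF (blk : S → g.Site) (A : κ → S → 𝔸) (ρ d₀ δ M₂ α₁ : ℝ)
    (hα₁ : 0 ≤ α₁) (hδ : 0 ≤ δ) (hM₂ : 0 ≤ M₂) (hrepr : ∀ (v : 𝔸) (i : ι), |b.repr v i| ≤ M₂ * ‖v‖)
    (hlen : ∀ y : g.Site, 0 < g.len y)
    (hA : ∀ k x, ‖A k x‖ ≤ α₁ * (g.len (blk x))⁻¹) (hAτ : ∀ ν k x, ‖tauB T U ν (A k) x‖ ≤ α₁ * (g.len (blk x))⁻¹)
    (hρ : ∀ μ x, ‖((U μ x : 𝔸ˣ) : 𝔸)‖ ≤ ρ ∧ ‖(((U μ x)⁻¹ : 𝔸ˣ) : 𝔸)‖ ≤ ρ)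
    (hd₀ : ∀ μ x, g.dist (blk x) (blk ((T μ).symm x)) ≤ d₀) (hd₀0 : ∀ y : g.Site, g.dist y y ≤ d₀) (k₀ : κ) :
    HasMajorant (g := toB6 g Rr H) (fun q : (κ × S) × ι => blk q.1.2) (conj b (mixLetterF T U A k₀))
      (fun y y' => (2 * (1 + 2 * ρ ^ 2) * Fintype.card κ * M₂ * (∑ i, ‖b i‖) * Real.exp (δ * d₀)) * α₁ * (g.len y)⁻¹ *
        Real.exp (-(δ * g.dist y y'))) := by
  have hc0 : ∀ y : g.Site, 0 ≤ 2 * (1 + 2 * ρ ^ 2) * Fintype.card κ * α₁ * (g.len y)⁻¹ := fun y => by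
    have := hlen y; positivity
  refine hasMajorant_mono (g := toB6 g Rr H) _
    (hasMajorant_conj_of_local (Rr := Rr) (H := H) b (fun p : κ × S => blk p.2)
      (fun p q => q.2 = p.2 ∨ ∃ ν, q.2 = (T ν).symm p.2)
      (fun y => 2 * (1 + 2 * ρ ^ 2) * Fintype.card κ * α₁ * (g.len y)⁻¹) d₀ δ M₂ hc0 hδ hM₂ hrepr ?_ (mixLetterF T U A k₀) ?_)
    fun y y' => le_of_eq (by ring)
  · rintro p q (h | ⟨ν, h⟩)
    · rw [h]; exact hd₀0 _
    · rw [h]; exact hd₀ ν p.2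
  · intro F p B hB
    have hB0 : 0 ≤ B := (norm_nonneg _).trans (hB p (Or.inl rfl))
    rw [mixLetterF_apply]
    -- each summand is bounded by 2(1+2ρ²)·α₁ℓ⁻¹·B
    have hterm : ∀ ν, ‖-((I : ℂ) • ad (tauB T U ν (A ν) p.2) (tauB T U ν (fun z => F (ν, z)) p.2))
        + (I : ℂ) • ad (tauB T U ν (A k₀) p.2) (tauB T U ν (fun z => F (ν, z)) p.2)
        - (I : ℂ) • ad (A k₀ p.2) (F (ν, p.2))‖ ≤ 2 * (1 + 2 * ρ ^ 2) * (α₁ * (g.len (blk p.2))⁻¹) * B := by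
      intro ν
      have hτF : ‖tauB T U ν (fun z => F (ν, z)) p.2‖ ≤ ρ ^ 2 * B := by
        rw [tauB_apply]
        refine (norm_Rinv_le_sq _ (hρ ν _).1 (hρ ν _).2 _).trans ?_
        exact mul_le_mul_of_nonneg_left (hB (ν, (T ν).symm p.2) (Or.inr ⟨ν, rfl⟩)) (sq_nonneg _)
      have h1 : ‖(I : ℂ) • ad (tauB T U ν (A ν) p.2) (tauB T U ν (fun z => F (ν, z)) p.2)‖
          ≤ 2 * (α₁ * (g.len (blk p.2))⁻¹) * (ρ ^ 2 * B) := norm_I_ad_le (hAτ ν ν p.2) hτF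
      have h2 : ‖(I : ℂ) • ad (tauB T U ν (A k₀) p.2) (tauB T U ν (fun z => F (ν, z)) p.2)‖
          ≤ 2 * (α₁ * (g.len (blk p.2))⁻¹) * (ρ ^ 2 * B) := norm_I_ad_le (hAτ ν k₀ p.2) hτF
      have h3 : ‖(I : ℂ) • ad (A k₀ p.2) (F (ν, p.2))‖ ≤ 2 * (α₁ * (g.len (blk p.2))⁻¹) * B :=
        norm_I_ad_le (hA k₀ p.2) (hB (ν, p.2) (Or.inl rfl))
      calc _ ≤ ‖-((I : ℂ) • ad (tauB T U ν (A ν) p.2) (tauB T U ν (fun z => F (ν, z)) p.2))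
              + (I : ℂ) • ad (tauB T U ν (A k₀) p.2) (tauB T U ν (fun z => F (ν, z)) p.2)‖
              + ‖(I : ℂ) • ad (A k₀ p.2) (F (ν, p.2))‖ := norm_sub_le _ _
        _ ≤ (‖-((I : ℂ) • ad (tauB T U ν (A ν) p.2) (tauB T U ν (fun z => F (ν, z)) p.2))‖
              + ‖(I : ℂ) • ad (tauB T U ν (A k₀) p.2) (tauB T U ν (fun z => F (ν, z)) p.2)‖)
              + ‖(I : ℂ) • ad (A k₀ p.2) (F (ν, p.2))‖ := add_le_add (norm_add_le _ _) le_rfl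
        _ = (‖(I : ℂ) • ad (tauB T U ν (A ν) p.2) (tauB T U ν (fun z => F (ν, z)) p.2)‖
              + ‖(I : ℂ) • ad (tauB T U ν (A k₀) p.2) (tauB T U ν (fun z => F (ν, z)) p.2)‖)
              + ‖(I : ℂ) • ad (A k₀ p.2) (F (ν, p.2))‖ := by rw [norm_neg]
        _ ≤ (2 * (α₁ * (g.len (blk p.2))⁻¹) * (ρ ^ 2 * B) + 2 * (α₁ * (g.len (blk p.2))⁻¹) * (ρ ^ 2 * B))
              + 2 * (α₁ * (g.len (blk p.2))⁻¹) * B := add_le_add (add_le_add h1 h2) h3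
        _ = 2 * (1 + 2 * ρ ^ 2) * (α₁ * (g.len (blk p.2))⁻¹) * B := by ring
    have hsum : ‖∑ ν, (-((I : ℂ) • ad (tauB T U ν (A ν) p.2) (tauB T U ν (fun z => F (ν, z)) p.2))
        + (I : ℂ) • ad (tauB T U ν (A k₀) p.2) (tauB T U ν (fun z => F (ν, z)) p.2)
        - (I : ℂ) • ad (A k₀ p.2) (F (ν, p.2)))‖
        ≤ Fintype.card κ * (2 * (1 + 2 * ρ ^ 2) * (α₁ * (g.len (blk p.2))⁻¹) * B) := by
      refine (norm_sum_le _ _).trans ?_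
      rw [← Finset.card_univ, ← nsmul_eq_mul, ← Finset.sum_const]
      exact Finset.sum_le_sum fun ν _ => hterm ν
    split_ifs with h
    · rw [one_smul]
      refine hsum.trans (le_of_eq ?_)
      ring
    · rw [zero_smul, norm_zero]
      exact mul_nonneg (hc0 _) hB0

/-- **`hV1` FOR EVERY COEFFICIENT LETTER `V¹_k` OF THE BRACKET** (`k ∈ κ ⊕ κ`): `conj b (V1Letter A k) ≺ c_B·α₁(Lʲη)⁻¹e^{−δd}` with
ONE constant `c_B = 2(2 + 2ρ²)(d + 1)·M₂(Σ‖b_i‖)e^{δd₀}` good for both kinds of index — the letter size `|V¹| ≦ O(1)α₁(Lʲη)⁻¹` of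
the gradient-form reading of (3.73) for the bracket part of `V₁(A)`, as a theorem about the concrete lattice operators.
[cite: Balaban1985BackgroundPropagators, (3.37) p.396 + (3.71) p.404–405 + (3.73) p.405; Balaban1984PropagatorsII, (2.51)–(2.52) p.232] -/
theorem hasMajorant_V1Letter (blk : S → g.Site) (A : κ → S → 𝔸) (ρ d₀ δ M₂ α₁ : ℝ)
    (hα₁ : 0 ≤ α₁) (hδ : 0 ≤ δ) (hM₂ : 0 ≤ M₂) (hrepr : ∀ (v : 𝔸) (i : ι), |b.repr v i| ≤ M₂ * ‖v‖)
    (hlen : ∀ y : g.Site, 0 < g.len y)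
    (hA : ∀ k x, ‖A k x‖ ≤ α₁ * (g.len (blk x))⁻¹) (hAτ : ∀ ν k x, ‖tauB T U ν (A k) x‖ ≤ α₁ * (g.len (blk x))⁻¹)
    (hρ : ∀ μ x, ‖((U μ x : 𝔸ˣ) : 𝔸)‖ ≤ ρ ∧ ‖(((U μ x)⁻¹ : 𝔸ˣ) : 𝔸)‖ ≤ ρ)
    (hd₀ : ∀ μ x, g.dist (blk x) (blk ((T μ).symm x)) ≤ d₀) (hd₀0 : ∀ y : g.Site, g.dist y y ≤ d₀) (k : κ ⊕ κ) :
    HasMajorant (g := toB6 g Rr H) (fun q : (κ × S) × ι => blk q.1.2) (conj b (V1Letter T U A k))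
      (fun y y' => (2 * (2 + 2 * ρ ^ 2) * (Fintype.card κ + 1) * M₂ * (∑ i, ‖b i‖) * Real.exp (δ * d₀)) * α₁ *
        (g.len y)⁻¹ * Real.exp (-(δ * g.dist y y'))) := by
  have hcoef := hasMajorant_coefLetter_bond (Rr := Rr) (H := H) b T U blk A d₀ δ M₂ α₁ hα₁ hδ hM₂ hrepr hlen
    (fun μ x => ⟨hA μ x, hAτ μ μ x⟩) hd₀0 k
  have hw : ∀ y y' : g.Site, 0 ≤ M₂ * (∑ i, ‖b i‖) * Real.exp (δ * d₀) * α₁ * (g.len y)⁻¹ *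
      Real.exp (-(δ * g.dist y y')) := fun y y' => by
    have := hlen y; positivity
  have hκ : (0 : ℝ) ≤ Fintype.card κ := Nat.cast_nonneg _
  rcases k with k₀ | k₀
  · rw [V1Letter_inl, conj_add]
    refine hasMajorant_mono (g := toB6 g Rr H) _
      (hasMajorant_add (g := toB6 g Rr H) _ hcoef
        (hasMajorant_mixLetterF (Rr := Rr) (H := H) b T U blk A ρ d₀ δ M₂ α₁ hα₁ hδ hM₂ hrepr hlen hA hAτ hρ hd₀ hd₀0 k₀))
      fun y y' => ?_
    nlinarith [hw y y', mul_nonneg hκ (hw y y'), mul_nonneg (sq_nonneg ρ) (hw y y'),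
      mul_nonneg (mul_nonneg (sq_nonneg ρ) hκ) (hw y y')]
  · rw [V1Letter_inr, conj_add]
    refine hasMajorant_mono (g := toB6 g Rr H) _
      (hasMajorant_add (g := toB6 g Rr H) _ hcoef
        (hasMajorant_mixLetterB (Rr := Rr) (H := H) b blk A d₀ δ M₂ α₁ hα₁ hδ hM₂ hrepr hlen hA hd₀0 k₀))
      fun y y' => ?_
    nlinarith [hw y y', mul_nonneg hκ (hw y y'), mul_nonneg (sq_nonneg ρ) (hw y y'),
      mul_nonneg (mul_nonneg (sq_nonneg ρ) hκ) (hw y y')]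

/-- **THE CONJUGATED GRADIENT FORM** (the `hV₃`-shape identity of the finite-sum device for the bracket part of `V₁(A)`):
`conj b (V₁brkOp c A) = conj b V⁰ + Σ_{k∈κ⊕κ} conj b (V¹_k) ∘ conj b (∇_k)`.
[cite: Balaban1985BackgroundPropagators, (3.71) p.404–405 + (3.73) p.405; Balaban1984PropagatorsII, (2.52)–(2.55) p.232] -/
theorem conj_V₁brkOp_eq_gradForm (c : ℂ) (A : κ → S → 𝔸) :
    conj b (V₁brkOp T U c A) = conj b (zeroLetter T U c A)
      + ∑ k ∈ Finset.univ, conj b (V1Letter T U A k) * conj b (diffLetter (bT T) (bU U) c k) := by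
  rw [V₁brkOp_eq_gradForm, conj_add, conj_finset_sum]
  simp only [B9Eq352DivFormLetters.conj_mul]

end Majorants0

end Literature.MathematicalPhysics.QuantumFieldTheory.Balaban1983to89.B9Eq371GradLetters
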